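import Mathlib
import Literature.Analysis.FluidPDE.HardSphereCollisionRecord
import Literature.MathematicalPhysics.KineticTheory.HardSphereEuler
import Literature.MathematicalPhysics.KineticTheory.HardSphereEulerProofs
import Summits.AtomisticToContinuum.HydrodynamicLimit.Theses.OneFlightGossipEngine
import HarnessLib

/-!
# `OneFlightGossipEngine.OneFlightLayeredChaos` — regime decomposition of the crux (frame objects + sorry-free composition)

Crux stmt-AtomisticToContinuum-14535, line `Sketch`, lead cycle c1 (prover-line-stmt-AtomisticToContinuum-14535-c1-0).
The objects every stub of the line is stated over, and the composition that turns stubs into the crux: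

* `OLC.Regime` — for each `(σ, n, N, Φ, i)` of the crux's frame an event of initial data; `Regime.inter/compl/univ`.
* `OLC.rhoStar σ = (√2 π σ²)⁻¹` — the shared mesh (the COARSEST admissible cell, `r_N = ℓ_N`; the `L¹(𝒢)` defect only
  grows with information, so the `∃ ρ` of the crux is witnessed once and for all by this value).
* `OLC.mfTime σ θ₀ N = (N+1)^{-1/3}/(σ²√θ₀)` — the mean free time up to an absolute constant.
* `OLC.RegimeTail θ₀ σ bound X`, `OLC.RegimeBody θ₀ X` — the crux's own tail/body at activity `a₀ = 1` and mesh
  `rhoStar σ`, with the window event `W` replaced by `W ∩ X` (lets inlined verbatim from the route decl).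
* `OLC.shortGap θ₀ u₀` — the short-gap regime `{|s_i − s_j| ≤ u₀ · mfTime}` (flight starts, from time `0`, of `i` and
  of its `n`-th partner before the `n`-th collision time of `i`).
* Composition (all proved): `abs_defect_split` (measure additivity over a null-measurable partition + triangle
  inequality), `nullMeasurableSet_of_good` (`P (Φ.good)ᶜ = 0`), `regimeBody_split`, `regimeBody_univ_of_split`,
  `localGibbsLaw_const_activity'` / `localGibbsLaw_zero_activity'` (the activity cancels from the canonical law —
  adapted from the crux disprover's `Cruxes/OneFlightLayeredChaos/Disproof.lean` §2, refuter cdisprove, which a Theorems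
  file may not import), and `oneFlightLayeredChaos_of_regimeBody_univ : (∀ θ₀ > 0, RegimeBody θ₀ univ) → OneFlightLayeredChaos`.

The line's stubs (registered on the item; NOT in this file): `stub_floppy : ∀ θ₀ > 0, ∃ u₀ > 0, RegimeBody θ₀ (shortGap θ₀ u₀)`,
`stub_dust : ∀ θ₀ > 0, ∀ u₀ > 0, RegimeBody θ₀ (shortGap θ₀ u₀).compl`, `stub_measurableSet_gap_le` (the short-gap event is
measurable on `Φ.good`). Grouping namespace `OLC` (= OneFlightLayeredChaos) keeps the generic names off the flat `Theorems` namespace.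
-/

open MeasureTheory Set
open Literature.Analysis.FluidPDE Literature.MathematicalPhysics.KineticTheory
open Summit.AtomisticToContinuum.HydrodynamicLimit.Theses.OneFlightGossipEngine

namespace Summit.AtomisticToContinuum.HydrodynamicLimit.Theorems.OLC

noncomputable section

/-- A REGIME of the crux `OneFlightLayeredChaos`: for each `(σ, n, N, Φ, i)` of its frame, an event of initial data
(the piece of the window event a stub is responsible for). [folklore] -/
abbrev Regime : Type :=
  ∀ (σ : ℝ) (n N : ℕ), HardSphereFlow (Torus.geometry (Fin 3)) (hsDiameter σ N) (N + 1) → Fin (N + 1) →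
    Set (Config (N + 1) (Fin 3) T3)

/-- Pointwise intersection of regimes. [folklore] -/
def Regime.inter (X Y : Regime) : Regime := fun σ n N Φ i => X σ n N Φ i ∩ Y σ n N Φ i

/-- Pointwise complement of a regime. [folklore] -/
def Regime.compl (X : Regime) : Regime := fun σ n N Φ i => (X σ n N Φ i)ᶜ

/-- The trivial regime (all initial data). [folklore] -/
def Regime.univ : Regime := fun _ _ _ _ _ => Set.univ

/-- The shared mesh schedule of the line: the coarsest admissible cell size `ρ⋆(σ) = (√2 π σ²)⁻¹` (`r_N = ℓ_N`, one
mean free path). [folklore] -/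
def rhoStar (σ : ℝ) : ℝ := (Real.sqrt 2 * Real.pi * σ ^ 2)⁻¹

/-- The mean free time in the crux's units up to an absolute constant: `(N+1)^{-1/3} / (σ² √θ₀)`
(`ℓ_N = (N+1)^{-1/3}/(√2πσ²)`, thermal speed `≍ √θ₀`). [folklore] -/
def mfTime (σ θ₀ : ℝ) (N : ℕ) : ℝ := ((N + 1 : ℕ) : ℝ) ^ (-(1 / 3 : ℝ)) / (σ ^ 2 * Real.sqrt θ₀)

/-- The tail of the crux at activity `1` and mesh `ρ⋆(σ)` with the window event cut down to the regime `X`: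
`∀ τ > 0 ∀ n ∃ N₀ ∀ N ≥ N₀ ∀ Φ i B, ∀ E ∈ 𝒢, |P(W ∩ A ∩ (X ∩ E)) − u(B)·P(W ∩ (X ∩ E))| ≤ bound`, the lets being
those of the route decl verbatim (`P` = global Gibbs law at `a₀ = 1`, `u₀ = 0`, temperature `θ₀`). [folklore] -/
def RegimeTail (θ₀ σ bound : ℝ) (X : Regime) : Prop :=
  ∀ τ : ℝ, 0 < τ → ∀ n : ℕ, ∃ N₀ : ℕ, ∀ N : ℕ, N₀ ≤ N →
    ∀ Φ : HardSphereFlow (Torus.geometry (Fin 3)) (hsDiameter σ N) (N + 1),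
    ∀ (i : Fin (N + 1)) (B : Set V3), MeasurableSet B →
    let G : Geometry (Fin 3) T3 := Torus.geometry (Fin 3)
    let ε : ℝ := hsDiameter σ N
    let w : ℝ := τ * ((N + 1 : ℕ) : ℝ) ^ (-(1 / 3 : ℝ))
    let q : T3 → (Fin 3 → ℤ) := Torus.coarseCell (rhoStar σ * ((N + 1 : ℕ) : ℝ) ^ (-(1 / 3 : ℝ)))
    let P : Measure (Config (N + 1) (Fin 3) T3) := localGibbsLaw σ (fun _ => 1) (fun _ => 0) (fun _ => θ₀) N Φ
    let W : Set (Config (N + 1) (Fin 3) T3) :=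
      {z | n + 1 ≤ Set.ncard (collisionTimesOf G ε (fun t => Φ.flow t z) i ∩ Set.Ioc 0 w)}
    let A : Set (Config (N + 1) (Fin 3) T3) := {z | (Φ.nthRecordOf i n z).outDir ∈ B}
    let u : ℝ := (((sphereMeasure (E := V3)) Set.univ)⁻¹ * (sphereMeasure (E := V3)) {ω | (ω : V3) ∈ B}).toReal
    ∀ E : Set (Config (N + 1) (Fin 3) T3),
      MeasurableSet[MeasurableSpace.comap (fun z => (Φ.coarsePastOf q i n z, Φ.nthPartnerOf i n z)) inferInstance] E →
      |(P (W ∩ A ∩ (X σ n N Φ i ∩ E))).toReal - u * (P (W ∩ (X σ n N Φ i ∩ E))).toReal| ≤ bound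

/-- The body of the crux at activity `1` and mesh `ρ⋆(σ)` for the regime `X`:
`∃ C p σ₀ > 0, ∀ σ ∈ (0, σ₀), RegimeTail θ₀ σ (C σ^p) X`. [folklore] -/
def RegimeBody (θ₀ : ℝ) (X : Regime) : Prop :=
  ∃ C : ℝ, 0 < C ∧ ∃ p : ℝ, 0 < p ∧ ∃ σ₀ : ℝ, 0 < σ₀ ∧ ∀ σ : ℝ, 0 < σ → σ < σ₀ →
    RegimeTail θ₀ σ (C * σ ^ p) X

/-- The SHORT-GAP regime `{|s_i − s_j| ≤ u₀ · mfTime}`: the two flight-start snapshots of the `n`-th collision of `i`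
are at most `u₀` mean free times apart. [folklore] -/
def shortGap (θ₀ u₀ : ℝ) : Regime := fun σ n N Φ i =>
  {z | |flightStart (Torus.geometry (Fin 3)) (hsDiameter σ N) (fun t => Φ.flow t z) 0 i (Φ.nthCollisionTimeOf i n z) -
        flightStart (Torus.geometry (Fin 3)) (hsDiameter σ N) (fun t => Φ.flow t z) 0 (Φ.nthPartnerOf i n z)
          (Φ.nthCollisionTimeOf i n z)| ≤ u₀ * mfTime σ θ₀ N}

/-! ## Composition lemmas -/

/-- Measure additivity in `toReal` form over the partition `{Y, Yᶜ}` (null-measurable `Y`, finite measure). [folklore] -/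
theorem measureReal_inter_split {Ω : Type*} [MeasurableSpace Ω] (P : Measure Ω) [IsFiniteMeasure P]
    (S F Y E : Set Ω) (hY : NullMeasurableSet Y P) :
    (P (S ∩ (F ∩ E))).toReal = (P (S ∩ (F ∩ Y ∩ E))).toReal + (P (S ∩ (F ∩ Yᶜ ∩ E))).toReal := by
  have h1 : S ∩ (F ∩ Y ∩ E) = S ∩ (F ∩ E) ∩ Y := by ext z; simp only [mem_inter_iff]; tauto
  have h2 : S ∩ (F ∩ Yᶜ ∩ E) = (S ∩ (F ∩ E)) \ Y := by
    ext z; simp only [mem_inter_iff, mem_sdiff, mem_compl_iff]; tauto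
  rw [h1, h2, ← ENNReal.toReal_add (measure_ne_top _ _) (measure_ne_top _ _), measure_inter_add_sdiff₀ _ hY]

/-- **Splitting the defect** over a null-measurable partition `{Y, Yᶜ}`:
`|P(W∩A∩(F∩E)) − u P(W∩(F∩E))| ≤ Σ_{Z ∈ {Y, Yᶜ}} |P(W∩A∩(F∩Z∩E)) − u P(W∩(F∩Z∩E))|`. [folklore] -/
theorem abs_defect_split {Ω : Type*} [MeasurableSpace Ω] (P : Measure Ω) [IsFiniteMeasure P]
    (W A F Y E : Set Ω) (u : ℝ) (hY : NullMeasurableSet Y P) :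
    |(P (W ∩ A ∩ (F ∩ E))).toReal - u * (P (W ∩ (F ∩ E))).toReal| ≤
      |(P (W ∩ A ∩ (F ∩ Y ∩ E))).toReal - u * (P (W ∩ (F ∩ Y ∩ E))).toReal| +
      |(P (W ∩ A ∩ (F ∩ Yᶜ ∩ E))).toReal - u * (P (W ∩ (F ∩ Yᶜ ∩ E))).toReal| := by
  rw [measureReal_inter_split P (W ∩ A) F Y E hY, measureReal_inter_split P W F Y E hY]
  calc |(P (W ∩ A ∩ (F ∩ Y ∩ E))).toReal + (P (W ∩ A ∩ (F ∩ Yᶜ ∩ E))).toReal -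
        u * ((P (W ∩ (F ∩ Y ∩ E))).toReal + (P (W ∩ (F ∩ Yᶜ ∩ E))).toReal)|
      = |((P (W ∩ A ∩ (F ∩ Y ∩ E))).toReal - u * (P (W ∩ (F ∩ Y ∩ E))).toReal) +
          ((P (W ∩ A ∩ (F ∩ Yᶜ ∩ E))).toReal - u * (P (W ∩ (F ∩ Yᶜ ∩ E))).toReal)| := by ring_nf
    _ ≤ _ := abs_add_le _ _

/-- A set measurable on the good set is null-measurable for the global Gibbs law (which gives `(Φ.good)ᶜ` zero
mass, being absolutely continuous with respect to the Liouville measure). [folklore] -/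
theorem nullMeasurableSet_of_good {σ a₀ θ₀ : ℝ} {N : ℕ}
    (Φ : HardSphereFlow (Torus.geometry (Fin 3)) (hsDiameter σ N) (N + 1))
    {Y : Set (Config (N + 1) (Fin 3) T3)} (hY : MeasurableSet (Φ.good ∩ Y)) :
    NullMeasurableSet Y (localGibbsLaw σ (fun _ => a₀) (fun _ => 0) (fun _ => θ₀) N Φ) := by
  have hc : localGibbsLaw σ (fun _ => a₀) (fun _ => 0) (fun _ => θ₀) N Φ Φ.goodᶜ = 0 := by
    rw [localGibbsLaw, particleLaw_eq]
    exact withDensity_absolutelyContinuous _ _ Φ.measure_compl_good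
  have h0 : localGibbsLaw σ (fun _ => a₀) (fun _ => 0) (fun _ => θ₀) N Φ (Y \ Φ.good) = 0 :=
    measure_mono_null (fun z hz => hz.2) hc
  have : Y = (Φ.good ∩ Y) ∪ (Y \ Φ.good) := by
    ext z; simp only [mem_union, mem_inter_iff, mem_sdiff]; tauto
  rw [this]
  exact hY.nullMeasurableSet.union (NullMeasurableSet.of_null h0)

/-- **Splitting a regime.** If the body holds on `X ∩ Y` and on `X ∩ Yᶜ`, and `Y` is measurable on the good set, it holds
on `X` (constants `C₁ + C₂`, `min p₁ p₂`, `min σ₁ σ₂ ½`, `max N₁ N₂`). [folklore] -/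
theorem regimeBody_split {θ₀ : ℝ} (hθ : 0 < θ₀) {X Y : Regime}
    (hY : ∀ σ n N (Φ : HardSphereFlow (Torus.geometry (Fin 3)) (hsDiameter σ N) (N + 1)) i,
      MeasurableSet (Φ.good ∩ Y σ n N Φ i))
    (h₁ : RegimeBody θ₀ (X.inter Y)) (h₂ : RegimeBody θ₀ (X.inter Y.compl)) : RegimeBody θ₀ X := by
  obtain ⟨C₁, hC₁, p₁, hp₁, σ₁, hσ₁, H₁⟩ := h₁
  obtain ⟨C₂, hC₂, p₂, hp₂, σ₂, hσ₂, H₂⟩ := h₂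
  refine ⟨C₁ + C₂, by positivity, min p₁ p₂, lt_min hp₁ hp₂, min (min σ₁ σ₂) (1 / 2),
    lt_min (lt_min hσ₁ hσ₂) (by norm_num), fun σ hσ hσ0 => ?_⟩
  have hσ1' : σ < σ₁ := lt_of_lt_of_le hσ0 ((min_le_left _ _).trans (min_le_left _ _))
  have hσ2' : σ < σ₂ := lt_of_lt_of_le hσ0 ((min_le_left _ _).trans (min_le_right _ _))
  have hσh : σ ≤ 1 / 2 := (lt_of_lt_of_le hσ0 (min_le_right _ _)).le
  have hσ1 : σ ≤ 1 := hσh.trans (by norm_num)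
  intro τ hτ n
  obtain ⟨N₁, hN₁⟩ := H₁ σ hσ hσ1' τ hτ n
  obtain ⟨N₂, hN₂⟩ := H₂ σ hσ hσ2' τ hτ n
  refine ⟨max N₁ N₂, fun N hN Φ i B hB => ?_⟩
  have d₁ := hN₁ N ((le_max_left _ _).trans hN) Φ i B hB
  have d₂ := hN₂ N ((le_max_right _ _).trans hN) Φ i B hB
  intro G ε w q P W A u E hE
  have d₁ := d₁ E hE
  have d₂ := d₂ E hE
  simp only [Regime.inter, Regime.compl] at d₁ d₂
  haveI : IsProbabilityMeasure P :=
    isProbabilityMeasure_localGibbsLaw continuous_const continuous_const continuous_const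
      (fun _ => one_pos) (fun _ => hθ) hσh N Φ
  have hnull : NullMeasurableSet (Y σ n N Φ i) P := nullMeasurableSet_of_good Φ (hY σ n N Φ i)
  have hsplit := abs_defect_split P W A (X σ n N Φ i) (Y σ n N Φ i) E u hnull
  have hp1 : σ ^ p₁ ≤ σ ^ min p₁ p₂ := Real.rpow_le_rpow_of_exponent_ge hσ hσ1 (min_le_left _ _)
  have hp2 : σ ^ p₂ ≤ σ ^ min p₁ p₂ := Real.rpow_le_rpow_of_exponent_ge hσ hσ1 (min_le_right _ _)
  calc _ ≤ _ := hsplit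
    _ ≤ C₁ * σ ^ p₁ + C₂ * σ ^ p₂ := add_le_add d₁ d₂
    _ ≤ C₁ * σ ^ min p₁ p₂ + C₂ * σ ^ min p₁ p₂ := by gcongr
    _ = (C₁ + C₂) * σ ^ min p₁ p₂ := by ring

/-- Splitting the trivial regime: the body on `Y` and on `Yᶜ` (with `Y` measurable on the good set) give the body on
all initial data. [folklore] -/
theorem regimeBody_univ_of_split {θ₀ : ℝ} (hθ : 0 < θ₀) {Y : Regime}
    (hY : ∀ σ n N (Φ : HardSphereFlow (Torus.geometry (Fin 3)) (hsDiameter σ N) (N + 1)) i,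
      MeasurableSet (Φ.good ∩ Y σ n N Φ i))
    (h₁ : RegimeBody θ₀ Y) (h₂ : RegimeBody θ₀ Y.compl) : RegimeBody θ₀ Regime.univ := by
  have e₁ : Regime.univ.inter Y = Y := by
    funext σ n N Φ i; simp [Regime.inter, Regime.univ]
  have e₂ : Regime.univ.inter Y.compl = Y.compl := by
    funext σ n N Φ i; simp [Regime.inter, Regime.univ]
  have h₁' : RegimeBody θ₀ (Regime.univ.inter Y) := by rw [e₁]; exact h₁
  have h₂' : RegimeBody θ₀ (Regime.univ.inter Y.compl) := by rw [e₂]; exact h₂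
  exact regimeBody_split hθ hY h₁' h₂'

/-- `0 < √2 π σ²` for `0 < σ`. [folklore] -/
theorem sqrt_two_mul_pi_mul_sq_pos {σ : ℝ} (hσ : 0 < σ) : 0 < Real.sqrt 2 * Real.pi * σ ^ 2 := by
  have : 0 < Real.sqrt 2 := Real.sqrt_pos.2 (by norm_num)
  positivity

/-- `√2 · π · σ³ ≤ 1` for `0 ≤ σ ≤ 1/2` (so `σ ≤ ρ⋆(σ)`: the mesh `ρ⋆` is admissible). [folklore] -/
theorem sigma_mul_sqrt_two_pi_sq_le_one {σ : ℝ} (hσ : 0 ≤ σ) (hσ2 : σ ≤ 1 / 2) :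
    σ * (Real.sqrt 2 * Real.pi * σ ^ 2) ≤ 1 := by
  -- adapted from Cruxes/OneFlightLayeredChaos/Disproof.lean `rho_range_nonempty` (refuter cdisprove)
  have hs : Real.sqrt 2 ≤ 2 := by
    have h := Real.sqrt_le_sqrt (show (2 : ℝ) ≤ 2 ^ 2 by norm_num)
    rwa [Real.sqrt_sq (by norm_num : (0 : ℝ) ≤ 2)] at h
  have hpi : Real.pi ≤ 4 := Real.pi_le_four
  have hs0 : 0 ≤ Real.sqrt 2 := Real.sqrt_nonneg 2
  have hσ3 : σ ^ 3 ≤ (1 / 2) ^ 3 := pow_le_pow_left₀ hσ hσ2 3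
  calc σ * (Real.sqrt 2 * Real.pi * σ ^ 2) = Real.sqrt 2 * Real.pi * σ ^ 3 := by ring
    _ ≤ 2 * 4 * (1 / 2) ^ 3 := by gcongr
    _ ≤ 1 := by norm_num

/-! ## The activity drops out (adapted from the disprover's `Disproof.lean` §2) -/

/-- Tensor powers scale: `(c f)^{⊗n} = c^n f^{⊗n}`. [folklore] -/
theorem tensorPow_const_mul' {d : Type*} [Fintype d] {X : Type*} (c : ℝ) (n : ℕ)
    (f : X × EuclideanSpace ℝ d → ℝ) (w : Config n d X) :
    tensorPow n (fun y => c * f y) w = c ^ n * tensorPow n f w := by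
  simp [tensorPow, Finset.prod_mul_distrib, Finset.prod_const]

/-- The canonical density is invariant under scaling the one-particle profile by a nonzero constant. [folklore] -/
theorem canonicalDensity_const_mul' {d : Type*} [Fintype d] {X : Type*} [MeasureSpace X]
    (G : Geometry d X) (ε : ℝ) (n : ℕ) (f : X × EuclideanSpace ℝ d → ℝ) {c : ℝ} (hc : c ≠ 0) :
    canonicalDensity G ε n (fun y => c * f y) = canonicalDensity G ε n f := by
  have hind : (hardSphereDomain G n ε).indicator (tensorPow n fun y => c * f y) =
      fun w => c ^ n * (hardSphereDomain G n ε).indicator (tensorPow n f) w := by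
    funext w
    by_cases hw : w ∈ hardSphereDomain G n ε
    · simp [Set.indicator_of_mem hw, tensorPow_const_mul']
    · simp [Set.indicator_of_notMem hw]
  have hZ : canonicalPartition G ε n (fun y => c * f y) = c ^ n * canonicalPartition G ε n f := by
    simp only [canonicalPartition, hind, integral_const_mul]
  funext z
  simp only [canonicalDensity, hZ, hind, mul_inv]
  have hcn : c ^ n ≠ 0 := pow_ne_zero n hc
  field_simp

/-- **The activity drops out of the global Gibbs law**: for constant `a₀ ≠ 0`,
`localGibbsLaw σ a₀ 0 θ₀ N Φ = localGibbsLaw σ 1 0 θ₀ N Φ`. [folklore] -/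
theorem localGibbsLaw_const_activity' {a₀ : ℝ} (ha : a₀ ≠ 0) (σ : ℝ) (θ₀ : T3 → ℝ)
    (N : ℕ) (Φ : HardSphereFlow (Torus.geometry (Fin 3)) (hsDiameter σ N) (N + 1)) :
    localGibbsLaw σ (fun _ => a₀) (fun _ => 0) θ₀ N Φ = localGibbsLaw σ (fun _ => 1) (fun _ => 0) θ₀ N Φ := by
  have hprof : localGibbsProfile (fun _ => a₀) (fun _ => (0 : V3)) θ₀ =
      fun y => a₀ * localGibbsProfile (fun _ => 1) (fun _ => (0 : V3)) θ₀ y := by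
    funext y; simp [localGibbsProfile]
  rw [localGibbsLaw, localGibbsLaw, hprof, canonicalDensity_const_mul' _ _ _ _ ha]

/-! ## From the trivial regime to the crux -/

/-- **The crux from its body on the trivial regime.** If for every temperature the body holds on all initial data at
activity `1` and mesh `ρ⋆(σ)`, then `OneFlightLayeredChaos` holds: the `∃ ρ` of the crux is witnessed by `ρ⋆(σ)`
(`σ ≤ ρ⋆(σ)` for `σ ≤ ½`, `ρ⋆(σ)·√2πσ² = 1`), and a positive constant activity cancels from the canonical law
(`localGibbsLaw_const_activity'`). [folklore] -/
theorem oneFlightLayeredChaos_of_regimeBody_univ (h : ∀ θ₀ : ℝ, 0 < θ₀ → RegimeBody θ₀ Regime.univ) :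
    OneFlightLayeredChaos := by
  intro a₀ θ₀ ha hθ
  obtain ⟨C, hC, p, hp, σ₀, hσ₀, H⟩ := h θ₀ hθ
  refine ⟨C, hC, p, hp, min σ₀ (1 / 2), lt_min hσ₀ (by norm_num), fun σ hσ hσ1 => ?_⟩
  have hσ0 : σ < σ₀ := lt_of_lt_of_le hσ1 (min_le_left _ _)
  have hσh : σ ≤ 1 / 2 := (lt_of_lt_of_le hσ1 (min_le_right _ _)).le
  have hpos := sqrt_two_mul_pi_mul_sq_pos hσ
  refine ⟨rhoStar σ, ?_, ?_, ?_⟩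
  · rw [rhoStar, le_inv_comm₀ hσ hpos, inv_eq_one_div, le_div_iff₀ hσ]
    have h1 := sigma_mul_sqrt_two_pi_sq_le_one hσ.le hσh
    linarith [mul_comm σ (Real.sqrt 2 * Real.pi * σ ^ 2)]
  · rw [rhoStar, inv_mul_cancel₀ hpos.ne']
  · intro τ hτ n
    obtain ⟨N₀, hN₀⟩ := H σ hσ hσ0 τ hτ n
    refine ⟨N₀, fun N hN Φ i B hB => ?_⟩
    have key := hN₀ N hN Φ i B hB
    intro G ε w q P W A u E hE
    have key := key E hE
    simp only [Regime.univ, Set.univ_inter] at key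
    simp only [P, localGibbsLaw_const_activity' ha.ne']
    exact key

end

end Summit.AtomisticToContinuum.HydrodynamicLimit.Theorems.OLC
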